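import Summits.AtomisticToContinuum.HydrodynamicLimit.Theorems.BoxDissipativeWeakStrongLocalGibbsFineScaleTreeL1
import Summits.AtomisticToContinuum.HydrodynamicLimit.Theorems.BoxDissipativeWeakStrongLocalGibbsFineScaleKernels

/-!
# `LocalGibbsFineScale` (route `BoxDissipativeWeakStrong`), file 3: the one-point expectation of a
shrinking kernel, uniformly in the centre

Support lemmas for item stmt-AtomisticToContinuum-9905. For a family of averaging kernels
`g_N(x, ·) ≥ 0` on `𝕋³` (measurable, bounded, unit mass, supported in the sup-ball of radius
`r_N → 0` around `x`) we prove the **uniform one-point limit** of the canonical hard-sphere gas at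
small reduced density (`SmallDensity P σ`):

  `∀ s, ∀ δ > 0, ∀ᶠ N, ∀ x, |E_{N+1-s}[g_N(x, x₀)] - ρ₀(x)| ≤ δ`  (`onePt_kernel_uniform`),

`ρ₀ = rhoLim P σ` the limit density of the tree's cluster expansion (`HardSphereEulerLLN`). This is
the tree's `SmallDensity.tendsto_onePt` (one FIXED bounded test function, Tannery's theorem) made
uniform over the moving family: the size-form expansion `E = ∑_j C(N-s,j) W^{g}(j+1) r_N(j+1)` is
dominated termwise by `2e M θʲ` thanks to the `L¹`-normed tree bound (`MesoLLN.abs_coefN_le_integral`,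
`∫ g dμ ≤ M`), so a head/tail split reduces the claim to finitely many `j`, and for each `j` the
exact scaling identity `C(N-s,j) W^{g}(j+1) = C(N-s,j) ε_N^{3j} ∫ g β J_{ε_N}` (`Wd_self_eq_pow_mul`)
converges uniformly in the centre because `J_ε → b_j βʲ` uniformly (`MesoLLN.abs_Jint_sub_le`,
uniform continuity of `β`) and `∫ g_N(x, y) β(y)^{j+1} dy → β(x)^{j+1}` uniformly (averaging
lemma). Only `r_N → 0` is used here (not `(N+1) r_N³ → ∞`).

References: Spohn 1991, Part I §2.3; Pulvirenti–Tsagkarogiannis 2012 §5.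
-/

noncomputable section

namespace Summit.AtomisticToContinuum.HydrodynamicLimit.Theorems
namespace LGFS
open MeasureTheory Finset Filter Topology Metric
open Literature.Probability.LatticeModels Literature.MathematicalPhysics.StatisticalMechanics
  Literature.MathematicalPhysics.KineticTheory
open Literature.Analysis.FluidPDE.Torus (euclidDist)
open Literature.Analysis.FunctionSpaces (Torus.proj)
open scoped ENNReal

variable {P : DensityProfile} {σ : ℝ}

/-! ### Small arithmetic helpers -/

/-- For `ε > 0` and `K ≥ 0` there is `η > 0` with `K η ≤ ε`. -/
theorem exists_pos_mul_le {ε K : ℝ} (hε : 0 < ε) (hK : 0 ≤ K) : ∃ η : ℝ, 0 < η ∧ K * η ≤ ε := by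
  refine ⟨ε / (K + 1), div_pos hε (by linarith), ?_⟩
  rw [mul_div_assoc']
  exact (div_le_iff₀ (by linarith)).2 (by nlinarith)

/-- `∫ domF ≥ 0`. -/
theorem integral_domF_nonneg (P : DensityProfile) (k : ℕ) : 0 ≤ ∫ z, domF P k z :=
  integral_nonneg fun z => Set.indicator_nonneg (fun _ _ => by have := P.M_pos; positivity) z

/-! ### The size-form expansion of the one-point expectation and its termwise bound -/

/-- **Size-form expansion**: `E_{N+1-s}[χ(x₀)] = ∑_{j < N+1-s} C(N-s, j) W^χ_N(j+1) r_N(N+1-s, j+1)`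
for `s ≤ N` and `χ` bounded measurable. -/
theorem onePt_eq_sum {χ : T3 → ℝ} (hχ : Measurable χ) {C : ℝ} (hχC : ∀ y, |χ y| ≤ C) {N s : ℕ}
    (hN : s ≤ N) :
    onePt P σ χ N s =
      ∑ j ∈ range (N + 1 - s), coefN P σ N χ (N - s) j * rN P σ N (N + 1 - s) (j + 1) := by
  have hm1 : 1 ≤ N + 1 - s := by omega
  have hmn : N + 1 - s ≤ N + 1 := by omega
  rw [onePt, Md_eq_sum hχ hχC hm1 hmn, sum_div]
  refine sum_congr rfl fun j _ => ?_
  simp only [coefN, rN, XiN]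
  rw [show N + 1 - s - 1 = N - s by omega, show N + 1 - s - (j + 1) = N - s - j by omega]
  ring

/-- **Termwise geometric bound**: `|C(N-s,j) W^χ_N(j+1) r_N(N+1-s,j+1)| ≤ 2 e I θʲ` whenever
`∫ |χ| dμ ≤ I` and `j < N + 1 - s` (small density; `θ = geomRatio P σ`). -/
theorem abs_coefN_mul_rN_le (hs : SmallDensity P σ) {χ : T3 → ℝ} (hχ : Measurable χ) {C : ℝ}
    (hχC : ∀ y, |χ y| ≤ C) {I : ℝ} (hI : ∫ y, |χ y| ∂P.μ ≤ I) {N s j : ℕ} (hj : j < N + 1 - s) :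
    |coefN P σ N χ (N - s) j * rN P σ N (N + 1 - s) (j + 1)| ≤ 2 * Real.exp 1 * I * geomRatio P σ ^ j := by
  have hlam1 := hs.ovDensity_lt_one
  have hl0 := hs.ovDensity_nonneg
  have hI0 : 0 ≤ I := (integral_nonneg fun _ => abs_nonneg _).trans hI
  have hco := MesoLLN.abs_coefN_le_integral (P := P) hs.σ_pos.le hs.σ_lt_half hχ hχC
    (N := N) (m := N - s) (j := j) (by omega) (by omega)
  have hr0 : 0 ≤ rN P σ N (N + 1 - s) (j + 1) :=
    zero_le_one.trans (one_le_rN hs.σ_pos.le hs.σ_lt_half hlam1 (by omega) (by omega))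
  have hr2 := hs.rN_le_two_pow (N := N) (m := N + 1 - s) (j := j + 1) (by omega) (by omega)
  rw [abs_mul, abs_of_nonneg hr0]
  calc |coefN P σ N χ (N - s) j| * rN P σ N (N + 1 - s) (j + 1)
      ≤ (I * (Real.exp 1 * (Real.exp 1 * ovDensity P σ) ^ j)) * 2 ^ (j + 1) :=
        mul_le_mul (hco.trans (mul_le_mul_of_nonneg_right hI (by positivity))) hr2 hr0 (by positivity)
    _ = 2 * Real.exp 1 * I * geomRatio P σ ^ j := by rw [geomRatio]; ring

/-! ### The coefficients of a shrinking kernel converge uniformly in the centre -/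

/-- **Uniform convergence of the coefficients.** For a family of kernels `g_N(x, ·) ≥ 0`
(measurable, bounded by `C_N`, unit mass, supported where `dist y x < r_N`) with `r_N → 0`, every
shift `s` and every `j`:
`∀ η > 0, ∀ᶠ N, ∀ x, |C(N-s, j) W^{g_N(x,·)}_N(j+1) - γ_{j+1} β(x)^{j+1}| ≤ η`. -/
theorem coefN_kernel_uniform (hs : SmallDensity P σ) {g : ℕ → T3 → T3 → ℝ} {Cg r : ℕ → ℝ}
    (hgm : ∀ N x, Measurable (g N x)) (hg0 : ∀ N x y, 0 ≤ g N x y) (hgC : ∀ N x y, g N x y ≤ Cg N)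
    (hg1 : ∀ N x, ∫ y, g N x y = 1) (hsupp : ∀ N x y, g N x y ≠ 0 → dist y x < r N)
    (hr : Tendsto r atTop (𝓝 0)) (s j : ℕ) {η : ℝ} (hη : 0 < η) :
    ∀ᶠ N in atTop, ∀ x, |coefN P σ N (g N x) (N - s) j - clusterCoeff σ j * P.β x ^ (j + 1)| ≤ η := by
  have hσ := hs.σ_pos
  have hM := P.M_pos
  set Dm := ∫ z, domF P j z with hDm
  have hDm0 : 0 ≤ Dm := integral_domF_nonneg P j
  set a := (σ ^ 3) ^ j / (j.factorial : ℝ) with ha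
  have ha0 : 0 ≤ a := by positivity
  -- the three small parameters
  obtain ⟨η₁, hη₁, hη₁le⟩ := exists_pos_mul_le (ε := η / 3) (K := a * (P.M * (j * Dm))) (by positivity)
    (by positivity)
  obtain ⟨η₂, hη₂, hη₂le⟩ := exists_pos_mul_le (ε := η / 3) (K := a * |bE j|) (by positivity) (by positivity)
  -- uniform continuity of `β` (minimal-image distance) and of `β^{j+1}` (sup distance)
  obtain ⟨δ₁, hδ₁, hδ₁f⟩ := MesoLLN.exists_forall_euclidDist_lt_norm_sub_lt P.continuous hη₁
  obtain ⟨δ₂, hδ₂, hδ₂f⟩ := Metric.uniformContinuous_iff.1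
    (CompactSpace.uniformContinuous_of_continuous (P.continuous.pow (j + 1))) η₂ hη₂
  -- the eventual conditions on `N`
  have hE1 : ∀ᶠ N : ℕ in atTop, j ≤ N := eventually_ge_atTop j
  have hE2 : ∀ᶠ N : ℕ in atTop, (j : ℝ) * hsDiameter σ N < min (1 / 4) δ₁ := by
    have := (tendsto_hsDiameter σ).const_mul (j : ℝ)
    rw [mul_zero] at this
    exact this.eventually (gt_mem_nhds (lt_min (by norm_num) hδ₁))
  have hE3 : ∀ᶠ N : ℕ in atTop, r N < δ₂ := hr.eventually (gt_mem_nhds hδ₂)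
  have hE4 : ∀ᶠ N : ℕ in atTop, |((N - s).choose j : ℝ) * hsDiameter σ N ^ (3 * j) - a| * (P.M * Dm) ≤ η / 3 := by
    have h1 := tendsto_choose_sub_mul_hsDiameter_pow σ s j
    have h2 : Tendsto (fun N : ℕ => |((N - s).choose j : ℝ) * hsDiameter σ N ^ (3 * j) - a| * (P.M * Dm))
        atTop (𝓝 0) := by
      have := ((h1.sub_const a).abs.mul_const (P.M * Dm))
      rw [sub_self, abs_zero, zero_mul] at this
      exact this
    exact (h2.eventually (ge_mem_nhds (by positivity : (0 : ℝ) < η / 3))).mono fun N hN => hN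
  filter_upwards [hE1, hE2, hE3, hE4] with N hN1 hN2 hN3 hN4 x
  -- notation
  set ε := hsDiameter σ N with hε
  have hε0 : 0 < ε := hsDiameter_pos hσ N
  have hjε : (j : ℝ) * ε < 1 / 4 := hN2.trans_le (min_le_left _ _)
  have hjδ : (j : ℝ) * ε < δ₁ := hN2.trans_le (min_le_right _ _)
  set gx := g N x with hgx
  have hgxm : Measurable gx := hgm N x
  have hgxC : ∀ y, |gx y| ≤ Cg N := fun y => abs_le_of_nonneg_of_le (hg0 N x) (hgC N x) y
  -- the exact scaling identity
  haveI : NeZero (j + 1) := ⟨Nat.succ_ne_zero _⟩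
  have hcoef : coefN P σ N gx (N - s) j =
      (((N - s).choose j : ℝ) * ε ^ (3 * j)) * ∫ y, gx y * P.β y * Jint P ε j y := by
    rw [coefN, ← hε, Wd_eq_Wd_self P ε (show j + 1 ≤ N + 1 by omega) hgxm,
      Wd_self_eq_pow_mul P hε0 hjε hgxm hgxC, mul_assoc]
  set aN := ((N - s).choose j : ℝ) * ε ^ (3 * j) with haN
  set IN := ∫ y, gx y * P.β y * Jint P ε j y with hIN
  -- bounds on the pieces
  have hJb : ∀ y, |P.β y * Jint P ε j y| ≤ P.M * Dm := fun y => by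
    rw [abs_mul, abs_of_pos (P.pos y)]
    exact mul_le_mul (P.le_M y) (abs_Jint_le P ε j y) (abs_nonneg _) hM.le
  have hIN_le : |IN| ≤ P.M * Dm := by
    have h := abs_integral_kernel_mul_le hgxm (hg0 N x) (hgC N x) (hg1 N x)
      (fun y => P.β y * Jint P ε j y) hJb
    rw [hIN]
    simp_rw [mul_assoc]
    exact h
  -- modulus of `β` on the scale `j ε`
  have hmod1 : ∀ x' y : T3, euclidDist y x' ≤ j * ε → |P.β y - P.β x'| ≤ η₁ := by
    intro x' y hxy
    have h := hδ₁f y x' (hxy.trans_lt hjδ)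
    rw [Real.norm_eq_abs] at h
    exact h.le
  have hJint : ∀ y, |Jint P ε j y - bE j * P.β y ^ j| ≤ j * η₁ * Dm := fun y =>
    MesoLLN.abs_Jint_sub_le P j hε0.le hη₁.le hmod1 y
  -- first error: `∫ g (β J - bE β^{j+1})`
  have hF1 : |(∫ y, gx y * (P.β y * Jint P ε j y)) - ∫ y, gx y * (bE j * P.β y ^ (j + 1))| ≤
      P.M * (j * η₁ * Dm) := by
    have hm1 : Measurable fun y => P.β y * Jint P ε j y :=
      P.continuous.measurable.mul (measurable_Jint P ε j)
    have hm2 : Measurable fun y => bE j * P.β y ^ (j + 1) :=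
      measurable_const.mul (P.continuous.measurable.pow_const _)
    have hb2 : ∀ y, |bE j * P.β y ^ (j + 1)| ≤ |bE j| * P.M ^ (j + 1) := fun y => by
      rw [abs_mul, abs_of_nonneg (pow_nonneg (P.pos y).le _)]
      exact mul_le_mul_of_nonneg_left (pow_le_pow_left₀ (P.pos y).le (P.le_M y) _) (abs_nonneg _)
    rw [← integral_sub (integrable_kernel_mul hgxm (hg0 N x) (hgC N x) hm1 hJb)
      (integrable_kernel_mul hgxm (hg0 N x) (hgC N x) hm2 hb2)]
    have hdiff : ∀ y, |P.β y * Jint P ε j y - bE j * P.β y ^ (j + 1)| ≤ P.M * (j * η₁ * Dm) := by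
      intro y
      have : P.β y * Jint P ε j y - bE j * P.β y ^ (j + 1) = P.β y * (Jint P ε j y - bE j * P.β y ^ j) := by
        ring
      rw [this, abs_mul, abs_of_pos (P.pos y)]
      exact mul_le_mul (P.le_M y) (hJint y) (abs_nonneg _) hM.le
    have h := abs_integral_kernel_mul_le hgxm (hg0 N x) (hgC N x) (hg1 N x)
      (fun y => P.β y * Jint P ε j y - bE j * P.β y ^ (j + 1)) hdiff
    refine le_trans (le_of_eq ?_) h
    congr 1
    refine integral_congr_ae (ae_of_all _ fun y => ?_)
    ring
  -- second error: the average of `β^{j+1}` against the kernel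
  have hF2 : |(∫ y, gx y * P.β y ^ (j + 1)) - P.β x ^ (j + 1)| ≤ η₂ := by
    refine abs_integral_kernel_mul_sub_le hgxm (hg0 N x) (hgC N x) (hg1 N x) (hsupp N x)
      (P.continuous.measurable.pow_const _) (B := P.M ^ (j + 1)) (fun y => ?_) (fun y hy => ?_)
    · rw [abs_of_nonneg (pow_nonneg (P.pos y).le _)]
      exact pow_le_pow_left₀ (P.pos y).le (P.le_M y) _
    · have h := hδ₂f (hy.trans hN3)
      rw [Real.dist_eq] at h
      exact h.le
  -- assemble
  have hcc : clusterCoeff σ j = a * bE j := by rw [clusterCoeff, ha]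
  have hsplit : coefN P σ N gx (N - s) j - clusterCoeff σ j * P.β x ^ (j + 1) =
      (aN - a) * IN + a * ((∫ y, gx y * (P.β y * Jint P ε j y)) - ∫ y, gx y * (bE j * P.β y ^ (j + 1))) +
        a * bE j * ((∫ y, gx y * P.β y ^ (j + 1)) - P.β x ^ (j + 1)) := by
    have hI1 : IN = ∫ y, gx y * (P.β y * Jint P ε j y) := by
      rw [hIN]; refine integral_congr_ae (ae_of_all _ fun y => ?_); ring
    have hI2 : ∫ y, gx y * (bE j * P.β y ^ (j + 1)) = bE j * ∫ y, gx y * P.β y ^ (j + 1) := by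
      rw [← integral_const_mul]; refine integral_congr_ae (ae_of_all _ fun y => ?_); ring
    rw [hcoef, hcc, hI2, hI1]
    ring
  rw [hsplit]
  have hT1 : |(aN - a) * IN| ≤ η / 3 := by
    rw [abs_mul]
    exact (mul_le_mul_of_nonneg_left hIN_le (abs_nonneg _)).trans hN4
  have hT2 : |a * ((∫ y, gx y * (P.β y * Jint P ε j y)) - ∫ y, gx y * (bE j * P.β y ^ (j + 1)))| ≤ η / 3 := by
    rw [abs_mul, abs_of_nonneg ha0]
    calc a * |(∫ y, gx y * (P.β y * Jint P ε j y)) - ∫ y, gx y * (bE j * P.β y ^ (j + 1))|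
        ≤ a * (P.M * (j * η₁ * Dm)) := mul_le_mul_of_nonneg_left hF1 ha0
      _ = a * (P.M * (j * Dm)) * η₁ := by ring
      _ ≤ η / 3 := hη₁le
  have hT3 : |a * bE j * ((∫ y, gx y * P.β y ^ (j + 1)) - P.β x ^ (j + 1))| ≤ η / 3 := by
    rw [abs_mul, abs_mul, abs_of_nonneg ha0]
    calc a * |bE j| * |(∫ y, gx y * P.β y ^ (j + 1)) - P.β x ^ (j + 1)| ≤ a * |bE j| * η₂ :=
          mul_le_mul_of_nonneg_left hF2 (by positivity)
      _ ≤ η / 3 := hη₂le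
  calc |(aN - a) * IN + a * ((∫ y, gx y * (P.β y * Jint P ε j y)) - ∫ y, gx y * (bE j * P.β y ^ (j + 1))) +
        a * bE j * ((∫ y, gx y * P.β y ^ (j + 1)) - P.β x ^ (j + 1))|
      ≤ |(aN - a) * IN| + |a * ((∫ y, gx y * (P.β y * Jint P ε j y)) - ∫ y, gx y * (bE j * P.β y ^ (j + 1)))| +
        |a * bE j * ((∫ y, gx y * P.β y ^ (j + 1)) - P.β x ^ (j + 1))| := abs_add_three _ _ _
    _ ≤ η / 3 + η / 3 + η / 3 := add_le_add_three hT1 hT2 hT3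
    _ = η := by ring

/-! ### The one-point expectation of a shrinking kernel, uniformly in the centre -/

/-- **Termwise uniform convergence**: for every shift `s` and every `j`,
`∀ η > 0, ∀ᶠ N, ∀ x, |C(N-s,j) W^{g_N(x,·)}_N(j+1) r_N(N+1-s,j+1) - γ_{j+1} R^{j+1} β(x)^{j+1}| ≤ η`. -/
theorem coefN_mul_rN_kernel_uniform (hs : SmallDensity P σ) {g : ℕ → T3 → T3 → ℝ} {Cg r : ℕ → ℝ}
    (hgm : ∀ N x, Measurable (g N x)) (hg0 : ∀ N x y, 0 ≤ g N x y) (hgC : ∀ N x y, g N x y ≤ Cg N)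
    (hg1 : ∀ N x, ∫ y, g N x y = 1) (hsupp : ∀ N x y, g N x y ≠ 0 → dist y x < r N)
    (hr : Tendsto r atTop (𝓝 0)) (s j : ℕ) {η : ℝ} (hη : 0 < η) :
    ∀ᶠ N in atTop, ∀ x, |coefN P σ N (g N x) (N - s) j * rN P σ N (N + 1 - s) (j + 1) -
      clusterCoeff σ j * ratioLimit P σ ^ (j + 1) * P.β x ^ (j + 1)| ≤ η := by
  have hl0 := hs.ovDensity_nonneg
  set B := P.M * (Real.exp 1 * (Real.exp 1 * ovDensity P σ) ^ j) with hB
  have hB0 : 0 ≤ B := by have := P.M_pos; positivity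
  set R := ratioLimit P σ with hR
  have hR0 : 0 ≤ R ^ (j + 1) := pow_nonneg hs.ratioLimit_pos.le _
  have hR2 : R ^ (j + 1) ≤ 2 ^ (j + 1) := pow_le_pow_left₀ hs.ratioLimit_pos.le hs.ratioLimit_mem.2 _
  -- `r_N → R^{j+1}`
  obtain ⟨η₁, hη₁, hη₁le⟩ := exists_pos_mul_le (ε := η / 2) (K := B) (by positivity) hB0
  have hE1 : ∀ᶠ N : ℕ in atTop, |rN P σ N (N + 1 - s) (j + 1) - R ^ (j + 1)| ≤ η₁ := by
    have h := hs.tendsto_rN s (j + 1)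
    rw [← hR] at h
    have h2 : Tendsto (fun N => |rN P σ N (N + 1 - s) (j + 1) - R ^ (j + 1)|) atTop (𝓝 0) := by
      have := (h.sub_const (R ^ (j + 1))).abs
      rw [sub_self, abs_zero] at this
      exact this
    exact (h2.eventually (ge_mem_nhds hη₁)).mono fun N hN => hN
  -- the coefficients, uniformly
  obtain ⟨η₂, hη₂, hη₂le⟩ := exists_pos_mul_le (ε := η / 2) (K := (2 : ℝ) ^ (j + 1)) (by positivity)
    (by positivity)
  have hE2 := coefN_kernel_uniform hs hgm hg0 hgC hg1 hsupp hr s j hη₂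
  have hE3 : ∀ᶠ N : ℕ in atTop, j ≤ N := eventually_ge_atTop j
  filter_upwards [hE1, hE2, hE3] with N hN1 hN2 hN3 x
  have hco : |coefN P σ N (g N x) (N - s) j| ≤ B := by
    refine (MesoLLN.abs_coefN_le_integral (P := P) hs.σ_pos.le hs.σ_lt_half (hgm N x)
      (fun y => abs_le_of_nonneg_of_le (hg0 N x) (hgC N x) y) (N := N) (m := N - s) (j := j)
      hN3 (by omega)).trans ?_
    refine mul_le_mul_of_nonneg_right ?_ (by positivity)
    exact integral_abs_kernel_μ_le P (hgm N x) (hg0 N x) (hgC N x) (hg1 N x)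
  have hsplit : coefN P σ N (g N x) (N - s) j * rN P σ N (N + 1 - s) (j + 1) -
      clusterCoeff σ j * R ^ (j + 1) * P.β x ^ (j + 1) =
      coefN P σ N (g N x) (N - s) j * (rN P σ N (N + 1 - s) (j + 1) - R ^ (j + 1)) +
        (coefN P σ N (g N x) (N - s) j - clusterCoeff σ j * P.β x ^ (j + 1)) * R ^ (j + 1) := by ring
  rw [hsplit]
  calc |coefN P σ N (g N x) (N - s) j * (rN P σ N (N + 1 - s) (j + 1) - R ^ (j + 1)) +
        (coefN P σ N (g N x) (N - s) j - clusterCoeff σ j * P.β x ^ (j + 1)) * R ^ (j + 1)|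
      ≤ |coefN P σ N (g N x) (N - s) j| * |rN P σ N (N + 1 - s) (j + 1) - R ^ (j + 1)| +
        |coefN P σ N (g N x) (N - s) j - clusterCoeff σ j * P.β x ^ (j + 1)| * R ^ (j + 1) := by
        refine (abs_add_le _ _).trans (le_of_eq ?_)
        rw [abs_mul, abs_mul, abs_of_nonneg hR0]
    _ ≤ B * η₁ + η₂ * 2 ^ (j + 1) :=
        add_le_add (mul_le_mul hco hN1 (abs_nonneg _) hB0) (mul_le_mul (hN2 x) hR2 hR0 hη₂.le)
    _ ≤ η / 2 + η / 2 := add_le_add hη₁le (by rw [mul_comm]; exact hη₂le)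
    _ = η := by ring

/-- **The uniform one-point limit for a shrinking kernel.** For a family of kernels
`g_N(x, ·) ≥ 0` (measurable, bounded by `C_N`, unit mass, supported where `dist y x < r_N`) with
`r_N → 0`, and every shift `s`:
`∀ δ > 0, ∀ᶠ N, ∀ x, |E_{N+1-s}[g_N(x, x₀)] - ρ₀(x)| ≤ δ` with `ρ₀ = rhoLim P σ` (small density).
Head/tail split of the size-form expansion with the geometric majorant `2eM θʲ`, and the termwise
uniform limits `coefN_mul_rN_kernel_uniform`. -/
theorem onePt_kernel_uniform (hs : SmallDensity P σ) {g : ℕ → T3 → T3 → ℝ} {Cg r : ℕ → ℝ}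
    (hgm : ∀ N x, Measurable (g N x)) (hg0 : ∀ N x y, 0 ≤ g N x y) (hgC : ∀ N x y, g N x y ≤ Cg N)
    (hg1 : ∀ N x, ∫ y, g N x y = 1) (hsupp : ∀ N x y, g N x y ≠ 0 → dist y x < r N)
    (hr : Tendsto r atTop (𝓝 0)) (s : ℕ) {δ : ℝ} (hδ : 0 < δ) :
    ∀ᶠ N in atTop, ∀ x, |onePt P σ (g N x) N s - rhoLim P σ x| ≤ δ := by
  have hθ0 := hs.geomRatio_nonneg
  have hθ1 := hs.geomRatio_lt_one
  have hM := P.M_pos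
  set θ := geomRatio P σ with hθ
  set A := 2 * Real.exp 1 * P.M with hA
  have hA0 : 0 ≤ A := by positivity
  -- the tail index `J`
  have htail : Tendsto (fun J : ℕ => A * θ ^ J / (1 - θ)) atTop (𝓝 0) := by
    have := ((tendsto_pow_atTop_nhds_zero_of_lt_one hθ0 hθ1).const_mul A).div_const (1 - θ)
    rw [mul_zero, zero_div] at this
    exact this
  obtain ⟨J, hJ⟩ := (htail.eventually (ge_mem_nhds (by positivity : (0 : ℝ) < δ / 4))).exists
  have hgeo : HasSum (fun i : ℕ => A * θ ^ J * θ ^ i) (A * θ ^ J / (1 - θ)) := by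
    have h := (hasSum_geometric_of_lt_one hθ0 hθ1).mul_left (A * θ ^ J)
    rwa [← div_eq_mul_inv] at h
  -- the head: finitely many termwise uniform limits
  have hhead : ∀ᶠ N in atTop, ∀ j ∈ range J, ∀ x,
      |coefN P σ N (g N x) (N - s) j * rN P σ N (N + 1 - s) (j + 1) -
        clusterCoeff σ j * ratioLimit P σ ^ (j + 1) * P.β x ^ (j + 1)| ≤ δ / (2 * ((J : ℝ) + 1)) := by
    refine (Finset.eventually_all (range J)).2 fun j _ => ?_
    exact coefN_mul_rN_kernel_uniform hs hgm hg0 hgC hg1 hsupp hr s j (by positivity)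
  have hE : ∀ᶠ N : ℕ in atTop, s + J ≤ N := eventually_ge_atTop _
  filter_upwards [hhead, hE] with N hN hNJ x
  have hgxm := hgm N x
  have hgxC : ∀ y, |g N x y| ≤ Cg N := fun y => abs_le_of_nonneg_of_le (hg0 N x) (hgC N x) y
  have hI : ∫ y, |g N x y| ∂P.μ ≤ P.M := integral_abs_kernel_μ_le P hgxm (hg0 N x) (hgC N x) (hg1 N x)
  -- names for the terms
  set F : ℕ → ℝ := fun j => coefN P σ N (g N x) (N - s) j * rN P σ N (N + 1 - s) (j + 1) with hF
  set T : ℕ → ℝ := fun j => clusterCoeff σ j * ratioLimit P σ ^ (j + 1) * P.β x ^ (j + 1) with hT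
  have hFle : ∀ j, j < N + 1 - s → |F j| ≤ A * θ ^ j := fun j hj =>
    abs_coefN_mul_rN_le hs hgxm hgxC hI hj
  have hTle : ∀ j, |T j| ≤ A * θ ^ j := fun j => hs.abs_rhoLim_term_le j x
  -- expansion and splitting
  have hsumT := hs.summable_rhoLim x
  have hexp : onePt P σ (g N x) N s = ∑ j ∈ range J, F j + ∑ j ∈ Ico J (N + 1 - s), F j := by
    rw [onePt_eq_sum hgxm hgxC (show s ≤ N by omega), Finset.sum_range_add_sum_Ico _ (show J ≤ N + 1 - s by omega)]
  have hrho : rhoLim P σ x = ∑ j ∈ range J, T j + ∑' j, T (j + J) := by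
    rw [rhoLim, ← hsumT.sum_add_tsum_nat_add J]
  rw [hexp, hrho]
  -- the three pieces
  have h1 : |∑ j ∈ range J, F j - ∑ j ∈ range J, T j| ≤ δ / 2 := by
    rw [← sum_sub_distrib]
    calc |∑ j ∈ range J, (F j - T j)| ≤ ∑ j ∈ range J, |F j - T j| := abs_sum_le_sum_abs _ _
      _ ≤ ∑ _j ∈ range J, δ / (2 * ((J : ℝ) + 1)) := sum_le_sum fun j hj => hN j hj x
      _ = J * (δ / (2 * ((J : ℝ) + 1))) := by rw [sum_const, card_range, nsmul_eq_mul]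
      _ ≤ δ / 2 := by
          rw [mul_div_assoc', div_le_div_iff₀ (by positivity) (by positivity)]
          nlinarith
  have h2 : |∑ j ∈ Ico J (N + 1 - s), F j| ≤ δ / 4 := by
    calc |∑ j ∈ Ico J (N + 1 - s), F j| ≤ ∑ j ∈ Ico J (N + 1 - s), |F j| := abs_sum_le_sum_abs _ _
      _ ≤ ∑ j ∈ Ico J (N + 1 - s), A * θ ^ j := sum_le_sum fun j hj => hFle j (mem_Ico.1 hj).2
      _ = ∑ i ∈ range (N + 1 - s - J), A * θ ^ J * θ ^ i := by
          rw [sum_Ico_eq_sum_range]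
          refine sum_congr rfl fun i _ => ?_
          rw [pow_add]; ring
      _ ≤ A * θ ^ J / (1 - θ) := sum_le_hasSum _ (fun i _ => by positivity) hgeo
      _ ≤ δ / 4 := hJ
  have h3 : |∑' j, T (j + J)| ≤ δ / 4 := by
    refine le_trans ?_ hJ
    refine (Real.norm_eq_abs _).symm.trans_le (tsum_of_norm_bounded hgeo fun i => ?_)
    rw [Real.norm_eq_abs]
    calc |T (i + J)| ≤ A * θ ^ (i + J) := hTle (i + J)
      _ = A * θ ^ J * θ ^ i := by rw [pow_add]; ring
  have hsplit : ∑ j ∈ range J, F j + ∑ j ∈ Ico J (N + 1 - s), F j - (∑ j ∈ range J, T j + ∑' j, T (j + J)) =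
      (∑ j ∈ range J, F j - ∑ j ∈ range J, T j) + ∑ j ∈ Ico J (N + 1 - s), F j - ∑' j, T (j + J) := by
    ring
  rw [hsplit]
  calc |(∑ j ∈ range J, F j - ∑ j ∈ range J, T j) + ∑ j ∈ Ico J (N + 1 - s), F j - ∑' j, T (j + J)|
      ≤ |∑ j ∈ range J, F j - ∑ j ∈ range J, T j| + |∑ j ∈ Ico J (N + 1 - s), F j| + |∑' j, T (j + J)| := by
          have hx1 := abs_sub (∑ j ∈ range J, F j - ∑ j ∈ range J, T j + ∑ j ∈ Ico J (N + 1 - s), F j)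
            (∑' j, T (j + J))
          have hx2 := abs_add_le (∑ j ∈ range J, F j - ∑ j ∈ range J, T j) (∑ j ∈ Ico J (N + 1 - s), F j)
          linarith
    _ ≤ δ / 2 + δ / 4 + δ / 4 := add_le_add_three h1 h2 h3
    _ = δ := by ring

end LGFS
end Summit.AtomisticToContinuum.HydrodynamicLimit.Theorems
end
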